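import Mathlib.Data.Matrix.ColumnRowPartitioned
import Literature.Computability.AlgebraicComplexity.ABV17SingularLocusBound
import HarnessLib

/-!
# `ToricFixedPoints` / line `form_then_lift`, stub F1 (`stub_formDebordering`) — negative-side
kernel fact: the three-cycle cubic `G₃` has determinantal complexity exactly `7`

`G₃ = y₀₀ y₁₁ y₂₂ + y₀₁ y₁₂ y₂₀ + y₀₂ y₁₀ y₂₁` (the three "broken diagonals" of a `3 × 3` matrix,
`G₃ = (det₃ + per₃)/2` in characteristic `≠ 2`) is the `T̃`-weight cubic singled out in
`Cruxes/ToricFixedPoints/Disproof.lean` §6 (cycle 4) as the independent kill target for F1: the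
padded forms `ℓ^{m-3} · G₃(Y)` are `H₀(3,m)`-semi-invariant, and such a form can be a NON-toric
border point of `det_m` (an F1 counterexample) only for `bdc(ℓ^{m-3}G₃) ≤ m < dc(G₃)` — for
`m ≥ dc(G₃)` it is `det` of an affine matrix, i.e. of End-type, hence a toric limit.  This file pins
the right end of that window in the kernel:

* `six_le_height_singIdeal_G3` — `codim Sing(G₃) ≥ 6`: a prime containing the nine partials
  `∂G₃/∂y_{ij} = ` (product of the other two variables of the same broken diagonal) contains two of
  the three variables of each broken diagonal (von zur Gathen's chain argument,
  `VonZurGathen.card_le_height_ker_aeval`);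
* `seven_le_determinantalComplexity_G3` — **`dc(G₃) ≥ 7`** over every field, by the tree's PROVED
  Alper–Bogart–Velasco Thm. 1.2 (`alperBogartVelasco2017_thm_1_2_nat`: `dc ≥ codim Sing + 1` when
  `codim Sing > 4`, degree `> 2`);
* `determinantalComplexity_G3_le` — `dc(G₃) ≤ 7` by the explicit `7 × 7` affine matrix of the
  three-path branching program (two Schur complements, no determinant expansion), hence
  `determinantalComplexity_G3 : dc(G₃) = 7`.

Consequence recorded for the crux (no Lean content beyond the above): the F1 kill window for `G₃`
is `m ∈ {5, 6}` (`m = 3, 4` are excluded by the Landsberg–Manivel–Ressayre dual-variety bound,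
`dim Z(G₃)^∨ = 7 > 2m - 2`).  Honest framing: a statement about one cubic in nine variables;
VP ≠ VNP is not touched.
-/

noncomputable section

open MvPolynomial Finset

namespace Summit.ValiantsHypothesis.Cruxes.ToricFixedPoints.Negative

open Literature.Computability.AlgebraicComplexity

/-! Every statement below is about the explicit polynomial
`G₃ = X (0,0) * X (1,1) * X (2,2) + X (0,1) * X (1,2) * X (2,0) + X (0,2) * X (1,0) * X (2,1)`
(no definition is introduced, so that the file stays on the kernel-reviewed lane). -/

variable (K : Type*) [CommRing K]

/-- `G₃` is a cubic form. [folklore] -/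
theorem G3_isHomogeneous : (X (0, 0) * X (1, 1) * X (2, 2) + X (0, 1) * X (1, 2) * X (2, 0) + X (0, 2) * X (1, 0) * X (2, 1) :
      MvPolynomial (Fin 3 × Fin 3) K).IsHomogeneous 3 := by
  have h : ∀ a b c : Fin 3 × Fin 3,
      (X a * X b * X c : MvPolynomial (Fin 3 × Fin 3) K).IsHomogeneous 3 := fun a b c =>
    ((isHomogeneous_X K a).mul (isHomogeneous_X K b)).mul (isHomogeneous_X K c)
  exact ((h _ _ _).add (h _ _ _)).add (h _ _ _)

/-- `∂G₃/∂y_{ij} = y_{i+1,j+1} · y_{i+2,j+2}` (indices mod 3): the other two variables of the broken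
diagonal through `(i, j)`. [folklore] -/
theorem pderiv_G3 (i j : Fin 3) :
    pderiv (i, j) (X (0, 0) * X (1, 1) * X (2, 2) + X (0, 1) * X (1, 2) * X (2, 0) + X (0, 2) * X (1, 0) * X (2, 1) :
      MvPolynomial (Fin 3 × Fin 3) K) = X (i + 1, j + 1) * X (i + 2, j + 2) := by
  fin_cases i <;> fin_cases j <;>
    simp [Derivation.leibniz, pderiv_X, mul_comm]

/-- In a domain, three elements with pairwise vanishing products have at least two zeros among
them. [folklore] -/
theorem two_le_of_mul_eq_zero {L : Type*} [CommRing L] [IsDomain L] {u v w : L}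
    [Decidable (u = 0)] [Decidable (v = 0)] [Decidable (w = 0)]
    (huv : u * v = 0) (hvw : v * w = 0) (hwu : w * u = 0) :
    2 ≤ (if u = 0 then 1 else 0) + (if v = 0 then 1 else 0) + (if w = 0 then 1 else 0) := by
  rcases mul_eq_zero.1 huv with hu | hv
  · rcases mul_eq_zero.1 hvw with hv | hw
    · simp [hu, hv]
    · simp [hu, hw]
  · rcases mul_eq_zero.1 hwu with hw | hu
    · simp [hv, hw]
    · simp [hu, hv]

/-- **`codim Sing(G₃) ≥ 6`, prime by prime**: a prime of `K[y]` containing `G₃` and its partials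
contains at least six of the nine variables (two per broken diagonal), hence has height `≥ 6`
(`VonZurGathen.card_le_height_ker_aeval`). [folklore] -/
theorem six_le_height_of_singIdeal_G3_le {K : Type*} [Field K]
    (P : Ideal (MvPolynomial (Fin 3 × Fin 3) K)) [hP : P.IsPrime] (hle : singIdeal (X (0, 0) * X (1, 1) * X (2, 2) + X (0, 1) * X (1, 2) * X (2, 0) + X (0, 2) * X (1, 0) * X (2, 1) :
      MvPolynomial (Fin 3 × Fin 3) K) ≤ P) :
    (6 : ℕ∞) ≤ P.height := by
  classical
  let a : Fin 3 × Fin 3 → MvPolynomial (Fin 3 × Fin 3) K ⧸ P := fun x => Ideal.Quotient.mk P (X x)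
  have hker : RingHom.ker (aeval (R := K) a) = P := by
    have h : (aeval (R := K) a : MvPolynomial (Fin 3 × Fin 3) K →ₐ[K] _ ⧸ P) =
        Ideal.Quotient.mkₐ K P :=
      MvPolynomial.algHom_ext fun x => by simp [a]
    ext f
    rw [RingHom.mem_ker, show aeval (R := K) a f = Ideal.Quotient.mk P f by rw [h]; rfl,
      Ideal.Quotient.eq_zero_iff_mem]
  have hmul : ∀ i j : Fin 3, a (i + 1, j + 1) * a (i + 2, j + 2) = 0 := by
    intro i j
    have h := hle (pderiv_mem_singIdeal (X (0, 0) * X (1, 1) * X (2, 2) + X (0, 1) * X (1, 2) * X (2, 0) + X (0, 2) * X (1, 0) * X (2, 1) :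
      MvPolynomial (Fin 3 × Fin 3) K) (i, j))
    rw [pderiv_G3, ← Ideal.Quotient.eq_zero_iff_mem, map_mul] at h
    exact h
  let T : Finset (Fin 3 × Fin 3) := Finset.univ.filter fun x => a x = 0
  have hT : ∀ x ∈ T, a x = 0 := fun x hx => (Finset.mem_filter.1 hx).2
  have hcard : 6 ≤ T.card := by
    have e : T.card = ∑ x : Fin 3 × Fin 3, if a x = 0 then 1 else 0 := Finset.card_filter _ _
    rw [e, Fintype.sum_prod_type, Fin.sum_univ_three, Fin.sum_univ_three, Fin.sum_univ_three,
      Fin.sum_univ_three]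
    have h0 := two_le_of_mul_eq_zero (u := a (0, 0)) (v := a (1, 1)) (w := a (2, 2))
      (by simpa using hmul 2 2) (by simpa using hmul 0 0) (by simpa using hmul 1 1)
    have h1 := two_le_of_mul_eq_zero (u := a (0, 1)) (v := a (1, 2)) (w := a (2, 0))
      (by simpa using hmul 2 0) (by simpa using hmul 0 1) (by simpa using hmul 1 2)
    have h2 := two_le_of_mul_eq_zero (u := a (0, 2)) (v := a (1, 0)) (w := a (2, 1))
      (by simpa using hmul 2 1) (by simpa using hmul 0 2) (by simpa using hmul 1 0)
    linarith
  calc (6 : ℕ∞) ≤ T.card := by exact_mod_cast hcard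
    _ ≤ (RingHom.ker (aeval (R := K) a)).height := VonZurGathen.card_le_height_ker_aeval a T hT
    _ = P.height := by rw [hker]

/-- **`codim Sing(G₃) ≥ 6`** in the height currency of `ABV17SingularLocusBound.lean`:
`6 ≤ height (G₃, ∂G₃/∂y_{ij})`. [folklore] -/
theorem six_le_height_singIdeal_G3 (K : Type*) [Field K] :
    (6 : ℕ∞) ≤ (singIdeal (X (0, 0) * X (1, 1) * X (2, 2) + X (0, 1) * X (1, 2) * X (2, 0) + X (0, 2) * X (1, 0) * X (2, 1) :
      MvPolynomial (Fin 3 × Fin 3) K)).height := by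
  rw [Ideal.height_eq_inf_minimalPrimes]
  refine le_iInf₂ fun P hP => ?_
  haveI := hP.1.1
  exact six_le_height_of_singIdeal_G3_le P hP.1.2

/-- **`dc(G₃) ≥ 7`** over every field: Alper–Bogart–Velasco Thm. 1.2 (`dc ≥ codim Sing + 1`,
PROVED in the tree as `alperBogartVelasco2017_thm_1_2_nat`) with `codim Sing(G₃) ≥ 6 > 4` and
`deg G₃ = 3 > 2`. [cite: AlperBogartVelasco2017, Thm. 1.2] -/
theorem seven_le_determinantalComplexity_G3 (K : Type*) [Field K] :
    7 ≤ determinantalComplexity (X (0, 0) * X (1, 1) * X (2, 2) + X (0, 1) * X (1, 2) * X (2, 0) + X (0, 2) * X (1, 0) * X (2, 1) :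
      MvPolynomial (Fin 3 × Fin 3) K) :=
  alperBogartVelasco2017_thm_1_2_nat (G3_isHomogeneous K) (by norm_num) (c := 6) (by norm_num)
    (six_le_height_singIdeal_G3 K)

/-! ### The upper bound `dc(G₃) ≤ 7`: the three-path branching program as two Schur complements -/

/-- The `7 × 7` affine matrix of the three-path branching program for `G₃`, in block form on
`Fin 3 ⊕ (Fin 3 ⊕ Fin 1)`: `[[1, B], [C, D]]` with `B = [0 | c]`, `C = [-diag b ; 0]`,
`D = [[1, 0], [-a, 0]]`, where `a_k = y_{0,k}`, `b_k = y_{1,k+1}`, `c_k = y_{2,k+2}` are the three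
variables of the `k`-th broken diagonal; its determinant is `G₃` by two Schur complements
(`det [[1, B], [C, D]] = det (D - C B)`), the second leaving the `1 × 1` matrix `(Σ_k a_k b_k c_k)`.
[folklore] -/
theorem det_G3Matrix :
    (Matrix.fromBlocks 1
    (Matrix.fromCols (0 : Matrix (Fin 3) (Fin 3) (MvPolynomial (Fin 3 × Fin 3) K))
      (Matrix.replicateCol (Fin 1) fun k : Fin 3 => (X (2, k + 2) : MvPolynomial (Fin 3 × Fin 3) K)))
    (Matrix.fromRows
      (-Matrix.diagonal fun k : Fin 3 => (X (1, k + 1) : MvPolynomial (Fin 3 × Fin 3) K))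
      (0 : Matrix (Fin 1) (Fin 3) (MvPolynomial (Fin 3 × Fin 3) K)))
    (Matrix.fromBlocks 1 0
      (-Matrix.replicateRow (Fin 1) fun k : Fin 3 => (X (0, k) : MvPolynomial (Fin 3 × Fin 3) K)) 0)).det =
    (X (0, 0) * X (1, 1) * X (2, 2) + X (0, 1) * X (1, 2) * X (2, 0) + X (0, 2) * X (1, 0) * X (2, 1) :
      MvPolynomial (Fin 3 × Fin 3) K) := by
  have hcol : (Matrix.diagonal fun k : Fin 3 => (X (1, k + 1) : MvPolynomial (Fin 3 × Fin 3) K)) *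
      Matrix.replicateCol (Fin 1) (fun k : Fin 3 => (X (2, k + 2) : MvPolynomial (Fin 3 × Fin 3) K)) =
      Matrix.replicateCol (Fin 1) fun k : Fin 3 =>
        (X (1, k + 1) * X (2, k + 2) : MvPolynomial (Fin 3 × Fin 3) K) := by
    ext i j
    rw [Matrix.diagonal_mul, Matrix.replicateCol_apply, Matrix.replicateCol_apply]
  rw [Matrix.det_fromBlocks_one₁₁, Matrix.fromRows_mul_fromCols, Matrix.mul_zero,
    Matrix.zero_mul, Matrix.zero_mul, Matrix.neg_mul, hcol, sub_eq_add_neg, Matrix.fromBlocks_neg,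
    Matrix.fromBlocks_add]
  simp only [neg_zero, add_zero, zero_add, neg_neg]
  rw [Matrix.det_fromBlocks_one₁₁, Matrix.neg_mul, sub_neg_eq_add, zero_add, Matrix.det_unique,
    Matrix.replicateRow_mul_replicateCol_apply, dotProduct, Fin.sum_univ_three]
  have e1 : (1 : Fin 3) + 1 = 2 := by decide
  have e2 : (1 : Fin 3) + 2 = 0 := by decide
  have e3 : (2 : Fin 3) + 1 = 0 := by decide
  have e4 : (2 : Fin 3) + 2 = 1 := by decide
  have e5 : (0 : Fin 3) + 1 = 1 := by decide
  have e6 : (0 : Fin 3) + 2 = 2 := by decide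
  simp only [e1, e2, e3, e4, e5, e6]
  ring

/-- The three-path matrix reindexed to `Fin 7` is an affine determinantal representation of `G₃`. [folklore] -/
theorem hasDetRepr_G3 [Nontrivial K] : HasDetRepr (X (0, 0) * X (1, 1) * X (2, 2) + X (0, 1) * X (1, 2) * X (2, 0) + X (0, 2) * X (1, 0) * X (2, 1) :
      MvPolynomial (Fin 3 × Fin 3) K) 7 := by
  let e : Fin 3 ⊕ (Fin 3 ⊕ Fin 1) ≃ Fin 7 :=
    (Equiv.sumCongr (Equiv.refl (Fin 3)) finSumFinEquiv).trans finSumFinEquiv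
  refine ⟨Matrix.reindex e e (Matrix.fromBlocks 1
    (Matrix.fromCols (0 : Matrix (Fin 3) (Fin 3) (MvPolynomial (Fin 3 × Fin 3) K))
      (Matrix.replicateCol (Fin 1) fun k : Fin 3 => (X (2, k + 2) : MvPolynomial (Fin 3 × Fin 3) K)))
    (Matrix.fromRows
      (-Matrix.diagonal fun k : Fin 3 => (X (1, k + 1) : MvPolynomial (Fin 3 × Fin 3) K))
      (0 : Matrix (Fin 1) (Fin 3) (MvPolynomial (Fin 3 × Fin 3) K)))
    (Matrix.fromBlocks 1 0
      (-Matrix.replicateRow (Fin 1) fun k : Fin 3 => (X (0, k) : MvPolynomial (Fin 3 × Fin 3) K)) 0)), fun i j => ?_, ?_⟩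
  · rw [Matrix.reindex_apply, Matrix.submatrix_apply]
    have hX : ∀ x : Fin 3 × Fin 3, (X x : MvPolynomial (Fin 3 × Fin 3) K).totalDegree ≤ 1 :=
      fun x => (totalDegree_X (R := K) x).le
    have h10 : ∀ (p : Prop) [Decidable p],
        (if p then (1 : MvPolynomial (Fin 3 × Fin 3) K) else 0).totalDegree ≤ 1 := by
      intro p _
      split_ifs
      · rw [totalDegree_one]; exact zero_le_one
      · rw [totalDegree_zero]; exact zero_le_one
    rcases e.symm i with a | a | a <;> rcases e.symm j with b | b | b
    · simpa only [Matrix.fromBlocks_apply₁₁, Matrix.one_apply] using h10 (a = b)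
    · simp
    · simp
    · simp only [Matrix.fromBlocks_apply₂₁, Matrix.fromRows_apply_inl, Matrix.neg_apply,
        Matrix.diagonal_apply, totalDegree_neg]
      split_ifs
      · simpa only [totalDegree_neg] using hX (1, a + 1)
      · rw [totalDegree_zero]; exact zero_le_one
    · simpa only [Matrix.fromBlocks_apply₂₂, Matrix.fromBlocks_apply₁₁,
        Matrix.one_apply] using h10 (a = b)
    · simp
    · simp
    · simp
    · simp
  · rw [Matrix.det_reindex_self, det_G3Matrix]

/-- **`dc(G₃) ≤ 7`** (the three-path branching program; every nontrivial commutative ring).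
[folklore] -/
theorem determinantalComplexity_G3_le [Nontrivial K] : determinantalComplexity (X (0, 0) * X (1, 1) * X (2, 2) + X (0, 1) * X (1, 2) * X (2, 0) + X (0, 2) * X (1, 0) * X (2, 1) :
      MvPolynomial (Fin 3 × Fin 3) K) ≤ 7 :=
  determinantalComplexity_le_of_hasDetRepr (hasDetRepr_G3 K)

/-- **`dc(G₃) = 7`** over every field. [cite: AlperBogartVelasco2017, Thm. 1.2] -/
theorem determinantalComplexity_G3 (K : Type*) [Field K] : determinantalComplexity (X (0, 0) * X (1, 1) * X (2, 2) + X (0, 1) * X (1, 2) * X (2, 0) + X (0, 2) * X (1, 0) * X (2, 1) :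
      MvPolynomial (Fin 3 × Fin 3) K) = 7 :=
  le_antisymm (determinantalComplexity_G3_le K) (seven_le_determinantalComplexity_G3 K)

end Summit.ValiantsHypothesis.Cruxes.ToricFixedPoints.Negative

end
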